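import Mathlib
import Summits.RiemannHypothesis.RiemannHypothesis.Theorems.WeilFarCoercivityFloor
import HarnessLib

/-!
# The Robin form of the PNT kernel is nonnegative off the ground state

Helper file (`--supports stmt-RiemannHypothesis-0098`, lead-track anchor: Weil-positivity window ladder, format-C far bound),
RH-free, pure real analysis.  Seat rh-explicit-weil-1 gen9 (memo `run/shared/lean/pub/rh-explicit/rh-explicit-weil-1/FORMAT-K3.md` §10.16).
The PNT kernel `K(x,y) = e^{|x−y|/2}` on `L²[−a, a]` (whose top eigenvalue `L(a) = pntFloor a` centres the floor law C-XIII) is the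
inverse of `D = d²/dx² − ¼` with the Robin conditions `u'(±a) = ±u(±a)/2`, so `⟨Kh, h⟩ = −Q(Kh)` with the ROBIN FORM
`Q(u) = ∫_{−a}^{a} u'² + ¼∫_{−a}^{a} u² − ½(u(a)² + u(−a)²)`.  This file proves the form inequality behind "`K` has exactly ONE
positive direction": for `κ > 0` with the eigen-condition `κ·sinh(κa) = cosh(κa)/2` (i.e. `κ = pntKappa a`),

* `endpoint_sq_le_of_zero` — `v(0) = 0 ⇒ v(a)² ≤ ∫₀ᵃ (2v'² + v²/2)` (AM–GM with the sharp constant);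
* `endpoint_sq_le_of_orth` — `∫₀ᵃ v·cosh(κ·) = 0 ⇒ v(a)² ≤ ∫₀ᵃ v'²` (write `v(a) = ∫₀ᵃ v'·W`, `W = sinh(κ·)/sinh(κa)`, and
  `∫₀ᵃ W² = 1 − a/(2 sinh²(κa)) ≤ 1` by the eigen-condition);
* ★ `robinForm_nonneg_of_orth` — for `u ∈ C¹` with `∫_{−a}^{a} u(x)cosh(κx) dx = 0`:
  `½(u(a)² + u(−a)²) ≤ ∫_{−a}^{a} u'² + ¼∫_{−a}^{a} u²` (parity split: even part ⊥ cosh, odd part vanishes at 0).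

Consequence (next file): `⟨Kh, h⟩ ≤ L(a)·⟨h, φ⟩²/‖φ‖²`, `φ = cosh(κ·)`, for the PNT kernel — the prime-shift operator's main term has
no other positive direction, so the upper clause of C-XIII is a statement about `T − K` alone.  Standard axioms only.
-/

set_option linter.dupNamespace false
set_option autoImplicit false

noncomputable section

open MeasureTheory Set intervalIntegral

namespace Summit.RiemannHypothesis.RiemannHypothesis.Theorems.WeilFormatC

namespace PNTKernel

variable {a κ : ℝ}

/-! ## §1 Two endpoint inequalities on `[0, a]` -/

/-- A Cauchy–Schwarz inequality for interval integrals of continuous functions: `(∫₀ᵃ f g)² ≤ (∫₀ᵃ f²)(∫₀ᵃ g²)` (`0 ≤ a`). -/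
theorem sq_integral_mul_le (ha : 0 ≤ a) {f g : ℝ → ℝ} (hf : Continuous f) (hg : Continuous g) :
    (∫ x in (0:ℝ)..a, f x * g x) ^ 2 ≤ (∫ x in (0:ℝ)..a, f x ^ 2) * ∫ x in (0:ℝ)..a, g x ^ 2 := by
  set A := ∫ x in (0:ℝ)..a, f x ^ 2 with hA
  set B := ∫ x in (0:ℝ)..a, f x * g x with hB
  set C := ∫ x in (0:ℝ)..a, g x ^ 2 with hC
  -- 0 ≤ ∫ (t f − g)² = t²A − 2tB + C for every t
  have hq : ∀ t : ℝ, 0 ≤ t ^ 2 * A - 2 * t * B + C := by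
    intro t
    have h0 : 0 ≤ ∫ x in (0:ℝ)..a, (t * f x - g x) ^ 2 :=
      intervalIntegral.integral_nonneg ha fun x _ ↦ sq_nonneg _
    have h1 : ∫ x in (0:ℝ)..a, (t * f x - g x) ^ 2 = t ^ 2 * A - 2 * t * B + C := by
      have e : ∀ x, (t * f x - g x) ^ 2 = t ^ 2 * f x ^ 2 - 2 * t * (f x * g x) + g x ^ 2 := fun x ↦ by ring
      simp_rw [e]
      have i1 : IntervalIntegrable (fun x ↦ t ^ 2 * f x ^ 2) volume 0 a := (by fun_prop : Continuous _).intervalIntegrable _ _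
      have i2 : IntervalIntegrable (fun x ↦ 2 * t * (f x * g x)) volume 0 a := (by fun_prop : Continuous _).intervalIntegrable _ _
      have i3 : IntervalIntegrable (fun x ↦ g x ^ 2) volume 0 a := (by fun_prop : Continuous _).intervalIntegrable _ _
      rw [intervalIntegral.integral_add (i1.sub i2) i3, intervalIntegral.integral_sub i1 i2,
        intervalIntegral.integral_const_mul, intervalIntegral.integral_const_mul]
    linarith
  have hA0 : 0 ≤ A := intervalIntegral.integral_nonneg ha fun x _ ↦ sq_nonneg _
  have hC0 : 0 ≤ C := intervalIntegral.integral_nonneg ha fun x _ ↦ sq_nonneg _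
  rcases eq_or_lt_of_le hA0 with hA0' | hApos
  · -- A = 0: then B = 0 (take t large)
    rw [← hA0'] at hq ⊢
    have hB0 : B = 0 := by
      by_contra hB
      have h1 := hq ((C + 1) / (2 * B))
      have h2 : 2 * ((C + 1) / (2 * B)) * B = C + 1 := by field_simp
      rw [mul_zero, zero_sub, h2] at h1
      linarith
    rw [hB0]; simp
  · have h := hq (B / A)
    have h2 : (B / A) ^ 2 * A - 2 * (B / A) * B + C = (A * C - B ^ 2) / A := by field_simp; ring
    rw [h2] at h
    have := (div_nonneg_iff.1 h)
    rcases this with ⟨h3, -⟩ | ⟨-, h4⟩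
    · linarith
    · linarith [lt_irrefl (0:ℝ), hApos]

/-- **Odd-type endpoint bound**: if `v(0) = 0` then `v(a)² ≤ ∫₀ᵃ (2v'² + v²/2)` (`v ∈ C¹`, `a ≥ 0`). -/
theorem endpoint_sq_le_of_zero (ha : 0 ≤ a) {v v' : ℝ → ℝ} (hv : ∀ x, HasDerivAt v (v' x) x) (hv' : Continuous v')
    (h0 : v 0 = 0) :
    v a ^ 2 ≤ ∫ x in (0:ℝ)..a, (2 * v' x ^ 2 + v x ^ 2 / 2) := by
  have hvc : Continuous v := continuous_iff_continuousAt.2 fun x ↦ (hv x).continuousAt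
  have hsq : ∀ x, HasDerivAt (fun x ↦ v x ^ 2) (2 * v x * v' x) x := fun x ↦
    ((hv x).fun_pow 2).congr_deriv (by norm_num)
  have hftc : ∫ x in (0:ℝ)..a, 2 * v x * v' x = v a ^ 2 - v 0 ^ 2 :=
    integral_eq_sub_of_hasDerivAt (fun x _ ↦ hsq x) ((by fun_prop : Continuous fun x ↦ 2 * v x * v' x).intervalIntegrable _ _)
  rw [h0] at hftc
  have hmono : ∫ x in (0:ℝ)..a, 2 * v x * v' x ≤ ∫ x in (0:ℝ)..a, (2 * v' x ^ 2 + v x ^ 2 / 2) :=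
    intervalIntegral.integral_mono_on ha ((by fun_prop : Continuous fun x ↦ 2 * v x * v' x).intervalIntegrable _ _)
      ((by fun_prop : Continuous fun x ↦ 2 * v' x ^ 2 + v x ^ 2 / 2).intervalIntegrable _ _)
      fun x _ ↦ by nlinarith [sq_nonneg (2 * v' x - v x)]
  nlinarith

/-- `∫₀ᵃ sinh²(κt) dt = sinh(κa)cosh(κa)/(2κ) − a/2` (`κ ≠ 0`). -/
theorem integral_sinh_sq (hκ : κ ≠ 0) (a : ℝ) :
    ∫ t in (0:ℝ)..a, Real.sinh (κ * t) ^ 2 = Real.sinh (κ * a) * Real.cosh (κ * a) / (2 * κ) - a / 2 := by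
  have hderiv : ∀ t ∈ uIcc (0:ℝ) a,
      HasDerivAt (fun t ↦ Real.sinh (κ * t) * Real.cosh (κ * t) / (2 * κ) - t / 2) (Real.sinh (κ * t) ^ 2) t := by
    intro t _
    have hk : HasDerivAt (fun t ↦ κ * t) κ t := by simpa using (hasDerivAt_id t).const_mul κ
    have hs := hk.sinh
    have hc := hk.cosh
    have h1 := ((hs.mul hc).div_const (2 * κ)).sub ((hasDerivAt_id t).div_const 2)
    refine h1.congr_deriv ?_
    have hch := Real.cosh_sq (κ * t)
    have key : Real.cosh (κ * t) * κ * Real.cosh (κ * t) + Real.sinh (κ * t) * (Real.sinh (κ * t) * κ)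
        = κ * (1 + 2 * Real.sinh (κ * t) ^ 2) := by
      linear_combination κ * hch
    rw [key]
    field_simp
    ring
  rw [integral_eq_sub_of_hasDerivAt hderiv ((by fun_prop : Continuous fun t ↦ Real.sinh (κ * t) ^ 2).intervalIntegrable _ _)]
  simp

/-- **Even-type endpoint bound**: if `κ > 0`, `κ·sinh(κa) = cosh(κa)/2` and `∫₀ᵃ v·cosh(κ·) = 0`, then `v(a)² ≤ ∫₀ᵃ v'²`
(`v ∈ C¹`, `a > 0`). -/
theorem endpoint_sq_le_of_orth (ha : 0 < a) (hκ : 0 < κ) (heig : κ * Real.sinh (κ * a) = Real.cosh (κ * a) / 2)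
    {v v' : ℝ → ℝ} (hv : ∀ x, HasDerivAt v (v' x) x) (hv' : Continuous v')
    (horth : ∫ x in (0:ℝ)..a, v x * Real.cosh (κ * x) = 0) :
    v a ^ 2 ≤ ∫ x in (0:ℝ)..a, v' x ^ 2 := by
  have hvc : Continuous v := continuous_iff_continuousAt.2 fun x ↦ (hv x).continuousAt
  set S := Real.sinh (κ * a) with hS
  have hSpos : 0 < S := Real.sinh_pos_iff.2 (mul_pos hκ ha)
  set W : ℝ → ℝ := fun t ↦ Real.sinh (κ * t) / S with hW
  -- (v W)' = v' W + v · κ cosh(κ t)/S, and ∫₀ᵃ (vW)' = v(a)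
  have hWd : ∀ t, HasDerivAt W (κ * Real.cosh (κ * t) / S) t := by
    intro t
    have hk : HasDerivAt (fun t ↦ κ * t) κ t := by simpa using (hasDerivAt_id t).const_mul κ
    have := hk.sinh.div_const S
    simpa [hW, mul_comm] using this
  have hprod : ∀ t, HasDerivAt (fun t ↦ v t * W t) (v' t * W t + v t * (κ * Real.cosh (κ * t) / S)) t :=
    fun t ↦ (hv t).mul (hWd t)
  have hWc : Continuous W := by simp only [hW]; fun_prop
  have hftc : ∫ t in (0:ℝ)..a, (v' t * W t + v t * (κ * Real.cosh (κ * t) / S)) = v a * W a - v 0 * W 0 :=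
    integral_eq_sub_of_hasDerivAt (fun t _ ↦ hprod t)
      ((by fun_prop : Continuous fun t ↦ v' t * W t + v t * (κ * Real.cosh (κ * t) / S)).intervalIntegrable _ _)
  have hWa : W a = 1 := by simp only [hW]; rw [hS]; field_simp
  have hW0 : W 0 = 0 := by simp [hW]
  rw [hWa, hW0, mul_one, mul_zero, sub_zero] at hftc
  have hsplit : ∫ t in (0:ℝ)..a, (v' t * W t + v t * (κ * Real.cosh (κ * t) / S))
      = (∫ t in (0:ℝ)..a, v' t * W t) + (κ / S) * ∫ t in (0:ℝ)..a, v t * Real.cosh (κ * t) := by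
    rw [intervalIntegral.integral_add ((by fun_prop : Continuous fun t ↦ v' t * W t).intervalIntegrable _ _)
      ((by fun_prop : Continuous fun t ↦ v t * (κ * Real.cosh (κ * t) / S)).intervalIntegrable _ _),
      ← intervalIntegral.integral_const_mul]
    congr 1
    refine integral_congr fun t _ ↦ ?_
    ring
  rw [hsplit, horth, mul_zero, add_zero] at hftc
  -- Cauchy–Schwarz and ∫ W² ≤ 1
  have hcs := sq_integral_mul_le ha.le hv' hWc
  rw [hftc] at hcs
  have hW2 : ∫ t in (0:ℝ)..a, W t ^ 2 ≤ 1 := by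
    have h1 : ∫ t in (0:ℝ)..a, W t ^ 2 = (∫ t in (0:ℝ)..a, Real.sinh (κ * t) ^ 2) / S ^ 2 := by
      rw [← intervalIntegral.integral_div]
      refine integral_congr fun t _ ↦ ?_
      simp only [hW]; ring
    rw [h1, integral_sinh_sq hκ.ne' a, div_le_one (by positivity)]
    -- sinh·cosh/(2κ) − a/2 ≤ sinh², using cosh = 2κ sinh
    have hc : Real.cosh (κ * a) = 2 * κ * S := by rw [hS]; linarith
    rw [hc]
    have : S * (2 * κ * S) / (2 * κ) = S ^ 2 := by field_simp
    rw [this]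
    linarith
  have hpos : 0 ≤ ∫ t in (0:ℝ)..a, v' t ^ 2 := intervalIntegral.integral_nonneg ha.le fun t _ ↦ sq_nonneg _
  nlinarith

/-! ## §2 The Robin form on `[−a, a]` -/

/-- **The Robin form of the PNT kernel is nonnegative off the ground state**: for `a > 0`, `κ > 0` with
`κ·sinh(κa) = cosh(κa)/2`, and `u ∈ C¹` with `∫_{−a}^{a} u(x)·cosh(κx) dx = 0`,
`½(u(a)² + u(−a)²) ≤ ∫_{−a}^{a} u'² + ¼∫_{−a}^{a} u²`. -/
theorem robinForm_nonneg_of_orth (ha : 0 < a) (hκ : 0 < κ) (heig : κ * Real.sinh (κ * a) = Real.cosh (κ * a) / 2)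
    {u u' : ℝ → ℝ} (hu : ∀ x, HasDerivAt u (u' x) x) (hu' : Continuous u')
    (horth : ∫ x in (-a)..a, u x * Real.cosh (κ * x) = 0) :
    (u a ^ 2 + u (-a) ^ 2) / 2 ≤ (∫ x in (-a)..a, u' x ^ 2) + (1 / 4) * ∫ x in (-a)..a, u x ^ 2 := by
  have huc : Continuous u := continuous_iff_continuousAt.2 fun x ↦ (hu x).continuousAt
  -- derivative of the reflection
  have hneg : ∀ x, HasDerivAt (fun x ↦ u (-x)) (-u' (-x)) x := by
    intro x
    have h := (hu (-x)).comp x (hasDerivAt_neg x)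
    change HasDerivAt (fun x ↦ u (-x)) _ x at h
    convert h using 1
    ring
  -- even and odd parts and their derivatives
  have hue_d : ∀ x, HasDerivAt (fun x ↦ (u x + u (-x)) / 2) ((u' x - u' (-x)) / 2) x := fun x ↦
    (((hu x).fun_add (hneg x)).div_const 2).congr_deriv (by ring)
  have huo_d : ∀ x, HasDerivAt (fun x ↦ (u x - u (-x)) / 2) ((u' x + u' (-x)) / 2) x := fun x ↦
    (((hu x).fun_sub (hneg x)).div_const 2).congr_deriv (by ring)
  have hue'c : Continuous fun x ↦ (u' x - u' (-x)) / 2 := by fun_prop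
  have huo'c : Continuous fun x ↦ (u' x + u' (-x)) / 2 := by fun_prop
  -- folding integrals over [−a, a] onto [0, a]
  have fold : ∀ g : ℝ → ℝ, Continuous g → ∫ x in (-a)..a, g x = ∫ x in (0:ℝ)..a, (g x + g (-x)) := by
    intro g hg
    have hi : ∀ s t : ℝ, IntervalIntegrable g volume s t := fun s t ↦ hg.intervalIntegrable s t
    rw [← integral_add_adjacent_intervals (hi (-a) 0) (hi 0 a),
      intervalIntegral.integral_add (hi 0 a) ((show Continuous fun x ↦ g (-x) by fun_prop).intervalIntegrable 0 a),
      intervalIntegral.integral_comp_neg, neg_zero]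
    ring
  -- orthogonality of the even part on [0, a]
  have horth' : ∫ x in (0:ℝ)..a, (u x + u (-x)) / 2 * Real.cosh (κ * x) = 0 := by
    have h1 := fold (fun x ↦ u x * Real.cosh (κ * x)) (by fun_prop)
    rw [horth] at h1
    have h2 : ∫ x in (0:ℝ)..a, (u x * Real.cosh (κ * x) + u (-x) * Real.cosh (κ * -x))
        = 2 * ∫ x in (0:ℝ)..a, (u x + u (-x)) / 2 * Real.cosh (κ * x) := by
      rw [← intervalIntegral.integral_const_mul]
      refine integral_congr fun x _ ↦ ?_
      simp only [mul_neg, Real.cosh_neg]; ring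
    rw [h2] at h1
    linarith
  have huo0 : (fun x ↦ (u x - u (-x)) / 2) 0 = 0 := by simp
  -- the two endpoint bounds
  have hE := endpoint_sq_le_of_orth ha hκ heig hue_d hue'c horth'
  have hO := endpoint_sq_le_of_zero ha.le huo_d huo'c huo0
  -- express everything through u
  have h1 : ∫ x in (-a)..a, u' x ^ 2
      = 2 * (∫ x in (0:ℝ)..a, ((u' x - u' (-x)) / 2) ^ 2) + 2 * ∫ x in (0:ℝ)..a, ((u' x + u' (-x)) / 2) ^ 2 := by
    rw [fold (fun x ↦ u' x ^ 2) (by fun_prop), ← intervalIntegral.integral_const_mul, ← intervalIntegral.integral_const_mul,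
      ← intervalIntegral.integral_add ((by fun_prop : Continuous fun x ↦ 2 * ((u' x - u' (-x)) / 2) ^ 2).intervalIntegrable _ _)
        ((by fun_prop : Continuous fun x ↦ 2 * ((u' x + u' (-x)) / 2) ^ 2).intervalIntegrable _ _)]
    refine integral_congr fun x _ ↦ ?_
    ring
  have h2 : ∫ x in (-a)..a, u x ^ 2
      = 2 * (∫ x in (0:ℝ)..a, ((u x + u (-x)) / 2) ^ 2) + 2 * ∫ x in (0:ℝ)..a, ((u x - u (-x)) / 2) ^ 2 := by
    rw [fold (fun x ↦ u x ^ 2) (by fun_prop), ← intervalIntegral.integral_const_mul, ← intervalIntegral.integral_const_mul,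
      ← intervalIntegral.integral_add ((by fun_prop : Continuous fun x ↦ 2 * ((u x + u (-x)) / 2) ^ 2).intervalIntegrable _ _)
        ((by fun_prop : Continuous fun x ↦ 2 * ((u x - u (-x)) / 2) ^ 2).intervalIntegrable _ _)]
    refine integral_congr fun x _ ↦ ?_
    ring
  have h3 : u a ^ 2 + u (-a) ^ 2 = 2 * ((u a + u (-a)) / 2) ^ 2 + 2 * ((u a - u (-a)) / 2) ^ 2 := by ring
  have hO' : ∫ x in (0:ℝ)..a, (2 * ((u' x + u' (-x)) / 2) ^ 2 + ((u x - u (-x)) / 2) ^ 2 / 2)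
      = 2 * (∫ x in (0:ℝ)..a, ((u' x + u' (-x)) / 2) ^ 2) + (1 / 2) * ∫ x in (0:ℝ)..a, ((u x - u (-x)) / 2) ^ 2 := by
    rw [← intervalIntegral.integral_const_mul, ← intervalIntegral.integral_const_mul,
      ← intervalIntegral.integral_add ((by fun_prop : Continuous fun x ↦ 2 * ((u' x + u' (-x)) / 2) ^ 2).intervalIntegrable _ _)
        ((by fun_prop : Continuous fun x ↦ 1 / 2 * ((u x - u (-x)) / 2) ^ 2).intervalIntegrable _ _)]
    refine integral_congr fun x _ ↦ ?_
    ring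
  rw [hO'] at hO
  have hue0 : 0 ≤ ∫ x in (0:ℝ)..a, ((u' x - u' (-x)) / 2) ^ 2 :=
    intervalIntegral.integral_nonneg ha.le fun x _ ↦ sq_nonneg _
  have hue2 : 0 ≤ ∫ x in (0:ℝ)..a, ((u x + u (-x)) / 2) ^ 2 :=
    intervalIntegral.integral_nonneg ha.le fun x _ ↦ sq_nonneg _
  rw [h1, h2, h3]
  nlinarith

end PNTKernel

end Summit.RiemannHypothesis.RiemannHypothesis.Theorems.WeilFormatC
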